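import Literature.NumberTheory.EllipticCurves.Sprung2012.ColemanPairUniqueProofs
import Literature.NumberTheory.EllipticCurves.Sprung2012.LocalTowerTraceProofs
import Literature.NumberTheory.EllipticCurves.Sprung2017.ChromaticLimitExistsProofs
import HarnessLib

/-!
# Sprung 2012, Props. 3.9 / 5.3 / 5.5, Cor. 5.6, Def. 5.9 (every class has a ♯/♭ Coleman value) —
# DISCHARGE of the named fact `Sprung2012.prop39_exists_isColemanPair`

Topic `Literature/NumberTheory/EllipticCurves`, cluster `Sprung2012`. PROOF file (one auxiliary `def`,
theorems, NO named fact; net debt −1), sequel of `ColemanPairUniqueProofs.lean`. The fact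
`prop39_exists_isColemanPair` of `ColemanMapTheorems.lean` (cell `bsd-ssimc`, seat kdot-split:
F. E. I. Sprung, J. Number Theory **132** (2012) [Sprung2012], Prop. 3.9 (p. 1491) "For `z ∈ H¹(k_n, T)`,
there are `(f♯(z), f♭(z)) ∈ Λ_n^{⊕2}` so that `(P¹_n(z), P⁰_n(z)) = (f♯(z), f♭(z)) 𝓗_n`", Props.
5.3/5.5, Cor. 5.6, Def. 5.9 (pp. 1493–1495) "Let the Coleman map `Col : H¹_Iw(T) → Λ ⊕ Λ` be the
projective limit of `Col_n`") HOLDS in its tree form: for a Honda system `(cneg, c)` and a local lift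
`g` of the generator, every functional `z` on `E(K_∞·K_v)` has a Coleman value
(`IsColemanPair κ ι W a_p g c z L♯ L♭`). PROOF (the printed one, tree currency): (1) the relative trace
through powers of the generator, `Tr_{n+1/n} y = ∑_{k<p} g^{pⁿk} y` for `y ∈ E(K_{n+1}·K_v)`
(`localTraceOfEmb_succ_eq_sum_pow_smul`, sibling file `LocalTowerTraceProofs.lean`: the cosets of `Gal(K̄_v/K_{n+1}K_v)` in `Gal(K̄_v/K_nK_v)` are
represented by the `g^{pⁿk}`, `k < p`, as `κ(res g) = 1`); (2) the pairing polynomials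
`Θ_n(x, z) = ∑_{j<pⁿ} z(gʲx)(1+T)ʲ ∈ ℤ_p[T]` (`thetaPoly` = Def. 3.1's `P_{n,x}(z)` lifted;
`colemanTheta_eq_thetaPoly`) are additive in `x`, satisfy LEVEL RAISING
`Θ_{n+1}(x, z) = Φ_{p^{n+1}}(1+T)·Θ_n(x, z)` for `x ∈ E(K_n·K_v)` (`thetaPoly_succ_of_mem_layer`; Sprung's
`ν`, Prop. 5.5) and TRACE COMPATIBILITY `Θ_{m+1}(y, z) ≡ Θ_m(Tr_{m+1/m} y, z) (mod ω_m)`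
(`omega_dvd_thetaPoly_succ_sub`; Prop. 5.5 / Kobayashi Lemma 8.15); (3) so the Honda relation
`Tr_{n+2/n+1} c_{n+2} = a_p c_{n+1} − c_n` (Thm. 2.2 (1)) makes `(Θ_n(c_n, z))_n` an integral QUEUE
SEQUENCE (`isQueueSequence_colemanTheta`), and (4) `Sprung2017.IsQueueSequence.exists_isChromaticLimit`
(Sprung 2017 Cor. 4.4 / "Prop. (𝔐 = 0)" = Sprung 2012 Props. 3.9, 5.3, 5.7, any integral queue
sequence, `p ∣ a_p`; seat bsd-littype-11 g2) yields the limit, a Coleman value by `coe_colemanTheta`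
(`exists_isColemanPair`, `prop39_exists_isColemanPair_holds`). Of the fact's hypotheses only `p ∣ a_p`,
the lift `g` and the levels + trace relations of the Honda system are used (the generation clauses are
not needed for existence). HONEST FRAMING (LITERATURE-TYPING layer D-0088(4), cell `bsd-littype`, seat
`bsd-littype-11` g3): a discharge; nothing about any curve is asserted; BSD is not proved by any of this.

References: [Sprung2012] Thm. 2.2 (p. 1487), Def. 3.1, Prop. 3.9 (pp. 1489–1491), Props. 5.3/5.5,
Cor. 5.6, Prop. 5.7, Def. 5.9 (pp. 1493–1495); [Sprung2017] ANT 11 (2017), Def. 1.7, Cor. 4.4,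
Thm. 1.12; [Kobayashi2003] Invent. Math. 152 (2003), Def. 1.1 (trace maps), Lemma 8.15.
-/

noncomputable section

open scoped Classical NumberField

open NumberField IsDedekindDomain Polynomial WeierstrassCurve Literature.NumberTheory.EllipticCurves
  Literature.NumberTheory.EllipticCurves.ZpExtension Literature.NumberTheory.EllipticCurves.Sprung2017
  Literature.NumberTheory.EllipticCurves.Kobayashi2003

universe u

namespace Literature.NumberTheory.EllipticCurves.Sprung2012

/-! ### The pairing polynomials `Θ_n(x, z) = ∑_{j<pⁿ} z(gʲ x)(1+T)ʲ` and their three identities -/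

section Pairing

variable {K : Type u} [Field K] {p : ℕ} [Fact p.Prime] (κ : ZpExtension K p)
variable {E : Type u} [Field E] [Algebra K E] (ι : AlgebraicClosure K →ₐ[K] AlgebraicClosure E)
variable (W : WeierstrassCurve K)

/-- A functional extended by zero is additive on its subgroup. [folklore] -/
private theorem evalOn_add_of_mem (A : AddSubgroup (localPoints W E)) (z : A →+ ℤ_[p])
    {P Q : localPoints W E} (hP : P ∈ A) (hQ : Q ∈ A) :
    evalOn W A z (P + Q) = evalOn W A z P + evalOn W A z Q := by
  rw [evalOn_of_mem W A z (add_mem hP hQ), evalOn_of_mem W A z hP, evalOn_of_mem W A z hQ, ← map_add]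
  rfl

/-- A functional extended by zero commutes with `ℤ`-multiples on its subgroup. [folklore] -/
private theorem evalOn_zsmul_of_mem (A : AddSubgroup (localPoints W E)) (z : A →+ ℤ_[p])
    {P : localPoints W E} (hP : P ∈ A) (k : ℤ) :
    evalOn W A z (k • P) = k • evalOn W A z P := by
  rw [evalOn_of_mem W A z (zsmul_mem hP k), evalOn_of_mem W A z hP, ← map_zsmul]
  congr 1

/-- A functional extended by zero is additive over finite sums inside its subgroup. [folklore] -/
private theorem evalOn_finset_sum_of_mem (A : AddSubgroup (localPoints W E)) (z : A →+ ℤ_[p])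
    {α : Type*} (s : Finset α) (P : α → localPoints W E) (hP : ∀ a ∈ s, P a ∈ A) :
    evalOn W A z (∑ a ∈ s, P a) = ∑ a ∈ s, evalOn W A z (P a) := by
  classical
  induction s using Finset.induction_on with
  | empty =>
    rw [Finset.sum_empty, Finset.sum_empty, evalOn_of_mem W A z A.zero_mem]
    exact map_zero z
  | insert a s ha ih =>
    rw [Finset.sum_insert ha, Finset.sum_insert ha,
      evalOn_add_of_mem W A z (hP a (Finset.mem_insert_self a s))
        (A.sum_mem fun b hb => hP b (Finset.mem_insert_of_mem hb)),
      ih fun b hb => hP b (Finset.mem_insert_of_mem hb)]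

/-- **The pairing polynomial** `Θ_n(x, z) := ∑_{j<pⁿ} z(gʲ•x)·(1+T)ʲ ∈ ℤ_p[T]` — the polynomial lift
of Sprung's `P_{n,x}(z)` (Def. 3.1) for a point `x` and a functional `z` on `E(K_∞·K_v)`;
`colemanTheta κ ι W g c z n = thetaPoly κ ι W g n (c n) z`. [cite: Sprung2012, Def. 3.1 (p. 1489)] -/
def thetaPoly (g : Field.absoluteGaloisGroup E) (n : ℕ) (x : localPoints W E)
    (z : localTowerPointsOfEmb κ ι W →+ ℤ_[p]) : ℤ_[p][X] :=
  ∑ j ∈ Finset.range (p ^ n),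
    Polynomial.C (evalOn W (localTowerPointsOfEmb κ ι W) z (g ^ j • x)) * (1 + Polynomial.X) ^ j

/-- `colemanTheta` is the pairing polynomial of the Honda point `c_n`. [cite: Sprung2012, Def. 3.1 (p. 1489)] -/
theorem colemanTheta_eq_thetaPoly (g : Field.absoluteGaloisGroup E) (c : ℕ → localPoints W E)
    (z : localTowerPointsOfEmb κ ι W →+ ℤ_[p]) (n : ℕ) :
    colemanTheta κ ι W g c z n = thetaPoly κ ι W g n (c n) z :=
  rfl

/-- `Θ_n` is additive in the point (points of `E(K_∞·K_v)`). [cite: Sprung2012, Def. 3.1 (p. 1489)] -/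
theorem thetaPoly_add (g : Field.absoluteGaloisGroup E) (n : ℕ) {x y : localPoints W E}
    (hx : x ∈ localTowerPointsOfEmb κ ι W) (hy : y ∈ localTowerPointsOfEmb κ ι W)
    (z : localTowerPointsOfEmb κ ι W →+ ℤ_[p]) :
    thetaPoly κ ι W g n (x + y) z = thetaPoly κ ι W g n x z + thetaPoly κ ι W g n y z := by
  rw [thetaPoly, thetaPoly, thetaPoly, ← Finset.sum_add_distrib]
  refine Finset.sum_congr rfl fun j _ => ?_
  rw [smul_add, evalOn_add_of_mem W _ z (smul_mem_localTowerPointsOfEmb κ ι W _ hx)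
    (smul_mem_localTowerPointsOfEmb κ ι W _ hy), map_add, add_mul]

/-- `Θ_n` commutes with `ℤ`-multiples of the point. [cite: Sprung2012, Def. 3.1 (p. 1489)] -/
theorem thetaPoly_zsmul (g : Field.absoluteGaloisGroup E) (n : ℕ) {x : localPoints W E}
    (hx : x ∈ localTowerPointsOfEmb κ ι W) (k : ℤ) (z : localTowerPointsOfEmb κ ι W →+ ℤ_[p]) :
    thetaPoly κ ι W g n (k • x) z = Polynomial.C (k : ℤ_[p]) * thetaPoly κ ι W g n x z := by
  rw [thetaPoly, thetaPoly, Finset.mul_sum]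
  refine Finset.sum_congr rfl fun j _ => ?_
  have h1 : g ^ j • (k • x) = k • (g ^ j • x) :=
    map_zsmul (DistribSMul.toAddMonoidHom (localPoints W E) (g ^ j)) k x
  rw [h1, evalOn_zsmul_of_mem W _ z (smul_mem_localTowerPointsOfEmb κ ι W _ hx), zsmul_eq_mul,
    map_mul, map_intCast, mul_assoc]

/-- `Θ_n` is subtractive in the point. [cite: Sprung2012, Def. 3.1 (p. 1489)] -/
theorem thetaPoly_sub (g : Field.absoluteGaloisGroup E) (n : ℕ) {x y : localPoints W E}
    (hx : x ∈ localTowerPointsOfEmb κ ι W) (hy : y ∈ localTowerPointsOfEmb κ ι W)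
    (z : localTowerPointsOfEmb κ ι W →+ ℤ_[p]) :
    thetaPoly κ ι W g n (x - y) z = thetaPoly κ ι W g n x z - thetaPoly κ ι W g n y z := by
  rw [sub_eq_add_neg, thetaPoly_add κ ι W g n hx (neg_mem hy), ← neg_one_zsmul y,
    thetaPoly_zsmul κ ι W g n hy, Int.cast_neg, Int.cast_one, map_neg, map_one, neg_one_mul,
    sub_eq_add_neg]

/-- Reindexing `∑_{j < b·a} f(j) = ∑_{i<a} ∑_{k<b} f(k + b i)`. [folklore] -/
private theorem sum_range_mul_left {M : Type*} [AddCommMonoid M] (f : ℕ → M) (b a : ℕ) :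
    ∑ j ∈ Finset.range (b * a), f j = ∑ i ∈ Finset.range a, ∑ k ∈ Finset.range b, f (k + b * i) := by
  induction a with
  | zero => simp
  | succ a ih =>
    rw [Nat.mul_succ, Finset.sum_range_add, ih, Finset.sum_range_succ]
    congr 1
    exact Finset.sum_congr rfl fun k _ => by rw [add_comm]

/-- `Φ_{p^{n+1}}(1+T) = ∑_{a<p} ((1+T)^{pⁿ})^a` over `ℤ_p`. [folklore] -/
private theorem cyclotomic_comp_map_eq_geom_sum (n : ℕ) :
    ((cyclotomic (p ^ (n + 1)) ℤ).comp (X + 1)).map (Int.castRingHom ℤ_[p]) =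
      ∑ a ∈ Finset.range p, ((1 + X : ℤ_[p][X]) ^ p ^ n) ^ a := by
  rw [Polynomial.map_comp, Polynomial.map_cyclotomic,
    Polynomial.cyclotomic_prime_pow_eq_geom_sum (Fact.out : p.Prime), Polynomial.map_add,
    Polynomial.map_X, Polynomial.map_one, Polynomial.sum_comp]
  refine Finset.sum_congr rfl fun a _ => ?_
  rw [Polynomial.pow_comp, Polynomial.pow_comp, Polynomial.X_comp, add_comm]

/-- **Level raising**: for `x` in the `n`-th local layer, `Θ_{n+1}(x, z) = Φ_{p^{n+1}}(1+T)·Θ_n(x, z)`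
(the orbit of `x` under `g` has length dividing `pⁿ`, so the `p^{n+1}` orbit sum is the `pⁿ` one
times `∑_{a<p} (1+T)^{pⁿa}`) — Sprung's `P_{n+1, x} = ν P_{n,x}`. [cite: Sprung2012, Prop. 5.5 (p. 1494)] -/
theorem thetaPoly_succ_of_mem_layer {g : Field.absoluteGaloisGroup E}
    (hg : κ.IsTopGenerator (resGalOfEmb ι g)) {n : ℕ} {x : localPoints W E}
    (hx : x ∈ localLayerPointsOfEmb κ ι W n) (z : localTowerPointsOfEmb κ ι W →+ ℤ_[p]) :
    thetaPoly κ ι W g (n + 1) x z =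
      ((cyclotomic (p ^ (n + 1)) ℤ).comp (X + 1)).map (Int.castRingHom ℤ_[p]) *
        thetaPoly κ ι W g n x z := by
  rw [cyclotomic_comp_map_eq_geom_sum, thetaPoly, thetaPoly, pow_succ, sum_range_mul_left,
    Finset.sum_mul]
  refine Finset.sum_congr rfl fun a _ => ?_
  rw [Finset.mul_sum]
  refine Finset.sum_congr rfl fun k _ => ?_
  rw [pow_add, mul_smul, pow_mul_smul_of_mem_localLayerPointsOfEmb κ ι W hg hx a, pow_add, pow_mul]
  ring

/-- **Trace compatibility**: for `y` in the `(m+1)`-st local layer,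
`Θ_{m+1}(y, z) ≡ Θ_m(Tr_{m+1/m} y, z) (mod ω_m)` — Sprung's "the projection of `P_{m+1,y}(z)` to
`Λ_m` is `P_{m, Tr y}(z)`" (compatibility of the pairings, Prop. 5.5 / Lemma 8.15 of Kobayashi).
[cite: Sprung2012, Prop. 5.5 (p. 1494)] [cite: Kobayashi2003, Lemma 8.15] -/
theorem omega_dvd_thetaPoly_succ_sub {g : Field.absoluteGaloisGroup E}
    (hg : κ.IsTopGenerator (resGalOfEmb ι g)) {m : ℕ} {y : localPoints W E}
    (hy : y ∈ localLayerPointsOfEmb κ ι W (m + 1)) (z : localTowerPointsOfEmb κ ι W →+ ℤ_[p]) :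
    (cyclotomicOmega p m).map (Int.castRingHom ℤ_[p]) ∣
      thetaPoly κ ι W g (m + 1) y z - thetaPoly κ ι W g m (localTraceOfEmb κ ι W m (m + 1) y) z := by
  have hω : (cyclotomicOmega p m).map (Int.castRingHom ℤ_[p]) = ((1 + X : ℤ_[p][X]) ^ p ^ m) - 1 := by
    rw [cyclotomicOmega, Polynomial.map_sub, Polynomial.map_pow, Polynomial.map_add, Polynomial.map_X,
      Polynomial.map_one, add_comm]
  have hyT : y ∈ localTowerPointsOfEmb κ ι W := localLayerPointsOfEmb_le_localTowerPointsOfEmb κ ι W _ hy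
  rw [localTraceOfEmb_succ_eq_sum_pow_smul κ ι W hg m hy, thetaPoly, thetaPoly, pow_succ,
    sum_range_mul_left]
  have h2 : ∀ k : ℕ,
      Polynomial.C (evalOn W (localTowerPointsOfEmb κ ι W) z
          (g ^ k • ∑ i ∈ Finset.range p, g ^ (p ^ m * i) • y)) * (1 + X) ^ k =
        ∑ i ∈ Finset.range p, Polynomial.C (evalOn W (localTowerPointsOfEmb κ ι W) z
          (g ^ (k + p ^ m * i) • y)) * (1 + X) ^ k := by
    intro k
    rw [Finset.smul_sum, evalOn_finset_sum_of_mem W _ z _ _ (fun i _ =>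
      smul_mem_localTowerPointsOfEmb κ ι W _ (smul_mem_localTowerPointsOfEmb κ ι W _ hyT)),
      map_sum, Finset.sum_mul]
    refine Finset.sum_congr rfl fun i _ => ?_
    rw [← mul_smul, ← pow_add]
  rw [Finset.sum_congr rfl fun k _ => h2 k, Finset.sum_comm, ← Finset.sum_sub_distrib]
  refine Finset.dvd_sum fun k _ => ?_
  rw [← Finset.sum_sub_distrib]
  refine Finset.dvd_sum fun i _ => ?_
  have hk : Polynomial.C (evalOn W (localTowerPointsOfEmb κ ι W) z (g ^ (k + p ^ m * i) • y)) *
        (1 + X) ^ (k + p ^ m * i) -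
      Polynomial.C (evalOn W (localTowerPointsOfEmb κ ι W) z (g ^ (k + p ^ m * i) • y)) * (1 + X) ^ k =
      Polynomial.C (evalOn W (localTowerPointsOfEmb κ ι W) z (g ^ (k + p ^ m * i) • y)) * (1 + X) ^ k *
        ((((1 + X : ℤ_[p][X]) ^ p ^ m) ^ i) - 1) := by
    rw [pow_add, pow_mul]
    ring
  rw [hk, hω]
  exact Dvd.dvd.mul_left (by simpa only [one_pow] using sub_dvd_pow_sub_pow ((1 + X : ℤ_[p][X]) ^ p ^ m) 1 i) _

end Pairing

/-! ### The pairing sequence of a Honda system is a queue sequence; existence of Coleman values -/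

section Existence

variable {K : Type u} [Field K] {p : ℕ} [Fact p.Prime] (κ : ZpExtension K p)
variable {E : Type u} [Field E] [Algebra K E] (ι : AlgebraicClosure K →ₐ[K] AlgebraicClosure E)
variable (W : WeierstrassCurve K)

/-- **`(P_{n,c_n}(z))_n` is an integral queue sequence** (Sprung 2017 Def. 1.7 / Sprung 2012 Prop. 5.5):
from the Honda relations `Tr_{n+2/n+1} c_{n+2} = a_p c_{n+1} − c_n` (`IsHondaSystem`), level raising
and trace compatibility give `Θ_{n+2} − a_p Θ_{n+1} + Φ_{p^{n+1}}(1+T) Θ_n ∈ ω_{n+1} ℤ_p[T]`.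
[cite: Sprung2012, Thm. 2.2 (1) (p. 1487) and Prop. 5.5 (p. 1494)] [cite: Sprung2017, Def. 1.7] -/
theorem isQueueSequence_colemanTheta {g : Field.absoluteGaloisGroup E}
    (hg : κ.IsTopGenerator (resGalOfEmb ι g)) {ap : ℤ} {cneg : localPoints W E}
    {c : ℕ → localPoints W E} (hH : IsHondaSystem κ ι W ap g cneg c)
    (z : localTowerPointsOfEmb κ ι W →+ ℤ_[p]) :
    IsQueueSequence p ap (colemanTheta κ ι W g c z) := by
  intro n
  have hcn : ∀ k, c k ∈ localLayerPointsOfEmb κ ι W k := hH.2.1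
  have hcT : ∀ k, c k ∈ localTowerPointsOfEmb κ ι W := fun k =>
    localLayerPointsOfEmb_le_localTowerPointsOfEmb κ ι W _ (hcn k)
  have htr : localTraceOfEmb κ ι W (n + 1) (n + 2) (c (n + 2)) = ap • c (n + 1) - c n := by
    have h := hH.2.2.2.2.1 (n + 1) (Nat.le_add_left 1 n)
    simpa only [Nat.add_sub_cancel] using h
  obtain ⟨q, hq⟩ := omega_dvd_thetaPoly_succ_sub κ ι W hg (hcn (n + 2)) z
  refine ⟨q, ?_⟩
  rw [colemanTheta_eq_thetaPoly, colemanTheta_eq_thetaPoly, colemanTheta_eq_thetaPoly,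
    ← thetaPoly_succ_of_mem_layer κ ι W hg (hcn n), ← thetaPoly_zsmul κ ι W g (n + 1) (hcT (n + 1)),
    sub_add, ← thetaPoly_sub κ ι W g (n + 1) (zsmul_mem (hcT (n + 1)) ap) (hcT n), ← htr]
  exact hq

/-- **Every functional has a Coleman value** (Sprung 2012 Props. 3.9 / 5.3 / 5.5, Cor. 5.6, Def. 5.9)
for a Honda system and `p ∣ a_p`: from `Sprung2017.IsQueueSequence.exists_isChromaticLimit`.
[cite: Sprung2012, Prop. 3.9 (p. 1491), Prop. 5.3 and Def. 5.9 (pp. 1493–1495)] [cite: Sprung2017, Thm. 1.12] -/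
theorem exists_isColemanPair {g : Field.absoluteGaloisGroup E}
    (hg : κ.IsTopGenerator (resGalOfEmb ι g)) {ap : ℤ} (hap : (p : ℤ) ∣ ap)
    {cneg : localPoints W E} {c : ℕ → localPoints W E} (hH : IsHondaSystem κ ι W ap g cneg c)
    (z : localTowerPointsOfEmb κ ι W →+ ℤ_[p]) :
    ∃ Lsharp Lflat : IwasawaAlgebra p, IsColemanPair κ ι W ap g c z Lsharp Lflat := by
  obtain ⟨Cs, Cf, h⟩ := (isQueueSequence_colemanTheta κ ι W hg hH z).exists_isChromaticLimit hap
  refine ⟨Cs, Cf, fun m => ?_⟩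
  obtain ⟨Q, hQ⟩ := h m
  refine ⟨Q, ?_⟩
  rw [← coe_colemanTheta]
  exact hQ

end Existence

/-- **DISCHARGE of `prop39_exists_isColemanPair`** (Sprung 2012 Props. 3.9 / 5.3 / 5.5, Cor. 5.6,
Def. 5.9: every class has a Coleman value). Of the fact's hypotheses only `p ∣ a_p`, the local lift `g`
of the generator and the Honda system are used (levels + trace relations; the generation clauses are
not needed for existence). [cite: Sprung2012, Prop. 3.9 (p. 1491), Prop. 5.3, Prop. 5.5, Cor. 5.6 and Def. 5.9 (pp. 1493–1495)] -/
theorem prop39_exists_isColemanPair_holds : prop39_exists_isColemanPair := by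
  intro W _ _ p _ _ _ hap κ γ _ _ _ v _ g hg cneg c hH z
  exact exists_isColemanPair κ (closureEmb (K := ℚ) (v.adicCompletion ℚ)) W hg hap hH z

end Literature.NumberTheory.EllipticCurves.Sprung2012

end
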